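import Summits.Ventures.PercRepro.ProfilePointedCircuitClassesInOutTenD

/-!
# PercRepro — THE IN–OUT INEQUALITY AT `n = 10` HOLDS AT EVERY POINT (p5, gen 40; `proofs/P5-GM1.md` §59)

The assembly of `InOutBottomFour` on `#E = 10`, `ρ(E) = 6`, at EVERY point `e`: a coloop `e` (`inCount_eq_zero_of_coloop`),
a coloop `x ≠ e` of `N` (the injection `W ↦ (E ∖ W) − x` of the demands into the units — the basis `E ∖ W` contains
`x`, and `W + x` stays independent), a coloop `x` of `N ∖ e` (the series-pair case `inCount_four_le_outCount_five_of_seriesPair`),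
and otherwise the theorem of part IV.

* `inCount_four_le_outCount_five_of_coloop_ne` (a coloop `x ≠ e`);
* **`inCount_four_le_outCount_five_of_card_ten`**: `in_4(e) ≤ out_5(e)` for every `e ∈ E` when `#E = ρ(E) + 4` and
  `ρ(E) = 6` — the `n = 10` case of `InOutBottomFour` with no condition on `e`.
-/

open scoped Matroid

namespace PercRepro.Cogirth

open Finset ThmH Skew Shadow Profile

variable {α : Type} [DecidableEq α] {N : Matroid α} [N.Finite] {e : α}

section InOutTenE




/-- A coloop `x ≠ e` of `N` (with `#E = 10`, `ρ(E) = 6`): every demand `W ∋ e` avoids `x` (the basis `E ∖ W` contains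
every coloop), and `W ↦ (E ∖ W) − x` injects the demands into the units (`E ∖ ((E ∖ W) − x) = W + x` is independent as
`x ∉ cl W`). -/
theorem inCount_four_le_outCount_five_of_coloop_ne (hn : (gr N).card = 10) (hR : rk N (gr N) = 6) {x : α}
    (hx : x ∈ gr N) (hxe : x ≠ e) (hco : rk N ((gr N).erase x) < 6) : inCount N 4 e ≤ outCount N 5 e := by
  unfold inCount outCount
  apply card_le_card_of_injOn (fun W => (gr N \ W).erase x)
  · intro W hW
    rw [mem_coe, mem_filter, mem_biIndepSets] at hW
    obtain ⟨⟨hWg, hW4, hWrk, hWc⟩, heW⟩ := hW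
    have hBcard : (gr N \ W).card = 6 := by rw [card_sdiff_of_subset hWg, hn, hW4]
    -- `x ∉ W`
    have hxW : x ∉ W := by
      intro hxW
      have hsub : gr N \ W ⊆ (gr N).erase x := by
        intro g hg
        rw [mem_sdiff] at hg
        exact mem_erase.2 ⟨fun h => hg.2 (h ▸ hxW), hg.1⟩
      have h1 := rk_mono' (M := N) hsub
      rw [hWc, hBcard] at h1
      omega
    have hxB : x ∈ gr N \ W := mem_sdiff.2 ⟨hx, hxW⟩
    -- `x ∉ cl W`
    have hxcl : x ∉ clF N W := by
      intro hxcl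
      have hWx : W ⊆ (gr N).erase x := fun g hg => mem_erase.2 ⟨fun h => hxW (h ▸ hg), hWg hg⟩
      have h1 : x ∈ clF N ((gr N).erase x) := mem_clF_of_subset hWx hxcl
      rw [mem_clF_iff_rk_insert_eq hx (erase_subset x (gr N)), insert_erase hx] at h1
      omega
    have hcompl : gr N \ (gr N \ W).erase x = insert x W := by
      ext g
      rw [mem_sdiff, mem_erase, mem_sdiff, mem_insert]
      constructor
      · rintro ⟨hg, h⟩
        by_cases hgW : g ∈ W
        · exact Or.inr hgW
        · by_cases hgx : g = x
          · exact Or.inl hgx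
          · exact absurd ⟨hgx, hg, hgW⟩ h
      · rintro (h | h)
        · subst h
          exact ⟨hx, fun h => h.1 rfl⟩
        · exact ⟨hWg h, fun h' => h'.2.2 h⟩
    rw [mem_coe, mem_filter, mem_biIndepSets]
    refine ⟨⟨(erase_subset _ _).trans sdiff_subset, ?_, ?_, ?_⟩, ?_⟩
    · rw [card_erase_of_mem hxB, hBcard]
    · rw [card_erase_of_mem hxB, hBcard]
      have := rk_eq_card_of_subset_of_rk_eq_card (M := N) (erase_subset x (gr N \ W)) hWc
      rwa [card_erase_of_mem hxB, hBcard] at this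
    · rw [hcompl, rk_insert_eq hx hWg, if_neg hxcl, hWrk, card_insert_of_notMem hxW]
    · intro he
      exact (mem_sdiff.1 (mem_of_mem_erase he)).2 heW
  · intro W₁ hW₁ W₂ hW₂ h
    rw [mem_coe, mem_filter, mem_biIndepSets] at hW₁ hW₂
    simp only at h
    have hx₁ : x ∈ gr N \ W₁ := by
      refine mem_sdiff.2 ⟨hx, fun hxW => ?_⟩
      have hsub : gr N \ W₁ ⊆ (gr N).erase x := by
        intro g hg
        rw [mem_sdiff] at hg
        exact mem_erase.2 ⟨fun h => hg.2 (h ▸ hxW), hg.1⟩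
      have h1 := rk_mono' (M := N) hsub
      rw [hW₁.1.2.2.2, card_sdiff_of_subset hW₁.1.1, hn, hW₁.1.2.1] at h1
      omega
    have hx₂ : x ∈ gr N \ W₂ := by
      refine mem_sdiff.2 ⟨hx, fun hxW => ?_⟩
      have hsub : gr N \ W₂ ⊆ (gr N).erase x := by
        intro g hg
        rw [mem_sdiff] at hg
        exact mem_erase.2 ⟨fun h => hg.2 (h ▸ hxW), hg.1⟩
      have h1 := rk_mono' (M := N) hsub
      rw [hW₂.1.2.2.2, card_sdiff_of_subset hW₂.1.1, hn, hW₂.1.2.1] at h1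
      omega
    have h2 : gr N \ W₁ = gr N \ W₂ := by
      rw [← insert_erase hx₁, ← insert_erase hx₂, h]
    rw [← Finset.sdiff_sdiff_eq_self hW₁.1.1, ← Finset.sdiff_sdiff_eq_self hW₂.1.1, h2]

/-- **THE IN–OUT INEQUALITY AT `n = 10`, EVERY POINT**: on every matroid with `#E = ρ(E) + 4` and `ρ(E) = 6`,
`in_4(e) ≤ out_5(e)` for every `e ∈ E`. -/
theorem inCount_four_le_outCount_five_of_card_ten (hn : (gr N).card = rk N (gr N) + 4) (hR : rk N (gr N) = 6)
    (he : e ∈ gr N) : inCount N 4 e ≤ outCount N 5 e := by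
  have hn' : (gr N).card = 10 := by omega
  -- `e` a coloop
  by_cases hce : rk N ((gr N).erase e) < rk N (gr N)
  · exact inCount_four_le_outCount_five_of_coloop hn hce
  have hnc : rk N ((gr N).erase e) = 6 := by
    have := rk_mono' (M := N) (erase_subset e (gr N))
    omega
  -- `E − e` coloop-free: the theorem of part III
  by_cases hall : ∀ x ∈ (gr N).erase e, rk N (((gr N).erase e).erase x) = 6
  · exact inCount_four_le_outCount_five_of_ten hn' hR he hnc hall
  obtain ⟨x, hx, hxr⟩ : ∃ x ∈ (gr N).erase e, rk N (((gr N).erase e).erase x) ≠ 6 := by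
    simpa only [not_forall, exists_prop] using hall
  have hxg : x ∈ gr N := (mem_erase.1 hx).2
  have hxe : x ≠ e := (mem_erase.1 hx).1
  -- `x` a coloop of `N`
  by_cases hcx : rk N ((gr N).erase x) < 6
  · exact inCount_four_le_outCount_five_of_coloop_ne hn' hR hxg hxe hcx
  -- otherwise `{e, x}` is a series pair
  have hcx' : rk N ((gr N).erase x) = rk N (gr N) := by
    have := rk_mono' (M := N) (erase_subset x (gr N))
    omega
  have hser : rk N (((gr N).erase e).erase x) + 1 = rk N (gr N) := by
    have h1 := rk_le_rk_erase_add_one (M := N) (erase_subset e (gr N)) hx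
    have h2 := rk_mono' (M := N) (erase_subset x ((gr N).erase e))
    omega
  exact inCount_four_le_outCount_five_of_seriesPair hn (by omega) he hxg (fun h => hxe h.symm)
    (hnc.trans hR.symm) hcx' hser

end InOutTenE

end PercRepro.Cogirth
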